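import Mathlib
import Literature.Combinatorics.SimpleGraph.LiftSparsityNumerics

/-!
# Imbrie (2016): the two-regime core of the cell's repair sketch R1′ for the §4.2.1 floating-graph count
(AUDIT-CELL LEMMAS for SURVIVAL.md §4E′ (iv⁗)(4)(G) and (R1′), revision 7; build tag b2b, seat b2b-imbrie-2-g7)

CITATION HEADER.  Source audited: J. Z. Imbrie, "On Many-Body Localization for Quantum Spin Chains",
J. Stat. Phys. 163 (2016) 998–1048 = arXiv:1403.7837v3 (bib key ImbrieJSP2016).  Passages (v3 TeX chunk
locators): §4.2.1 [p0018 l.16] ("Naïvely, the sum over g_{(i−1)',p} could produce a factor O(L_i)p, or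
O(L_i^n) n! in total. But we use this bound only when summing over long graphs … For long graphs, we sum
directly the series (ad A)^n/n!, so a combinatoric factor n! is admissible. But then the 1/n! is gone from the
estimate"); [p0018 l.18] ("We claim that no more than 2n/9 graphs g_{(i−1)',p} can fail to break new ground …
short graphs can be controlled with a combinatoric factor O(L_i^n) n^{2n/9} = O(L_i^n)(n!)^{2/9}"); (4.2),
(4.3), (4.6) [p0015 l.31–45, p0016 l.10] (inductive bounds (γ/ε)^{|g|}/(g!)^{2/9}; ḡ! = n!·∏_p g_p!); (4.8)
[p0016 l.27–28] (I: |E_σ − E_σ̃| < ε^{|ḡ|}; II: A^{prov}(ḡ) > (γ/ε)^{|ḡ|}/(ḡ!)^{2/9}); step 2 [p0013 l.42]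
("the sum over g₂ … is controlled by a combinatoric factor n! c^{|g₂|}. This is acceptable since we have
factors of 1/n!"); [p0026 l.18] ("in graphical expansions we retain that structure and the factorials that
go with it"); (4.32)–(4.33) [p0028 l.46] ("The inductive bound (4.6) applies to the numerator, and the
resonant condition (4.8)I bounds the denominator from below"), [p0028 l.52] ("Recall that γ = ε^{20}, so
c^{8/7} γ^{1/7} ε^{−16/7} ≤ 1").

WHAT THIS FILE IS.  The audit cell found (FloatingRatio.lean, SingleSiteGraphs.lean) families of ORDERED
short graphs whose floating fraction φ exceeds the printed budget exponent a = 2/9 (F1: φ = 15/64; F2: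
φ = 19/68 and 165/508), so that a count Kⁿ n^{φn} is not paid by Cⁿ(n!)^a for any constant C
(`count_exceeds_budget`).  Its repair SKETCH R1′ (SURVIVAL.md §4E′ (iv⁗)(4); the CELL's, NOT in the text,
NOT a reproduction of §4.2.1, NOT a claim that §4 stands) takes, for a certified child with n children of
its own, the minimum of two bounds assembled from printed ingredients: the threshold (4.8)II, which carries
only (n!)^a, and — off the resonant event (4.8)I — the full top factorial 1/n! at the price of a factor 2ⁿ
and a loss ε^{−ℓ_short} ≤ Λ^{(1−φ)n}, Λ := ε^{−L_i} (ℓ_short ≤ (1−φ) n L_i).  This file kernel-checks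
ONLY the real-analysis core of that sketch and its exact constants:
 * `self_rpow_le_of_factorial` (n^{an} ≤ (eⁿ)^a (n!)^a, from the landed nⁿ ≤ eⁿ·n! of
   Literature.Combinatorics.SimpleGraph.LiftSparsityNumerics, reused per the gate's dedup rule);
 * `full_factorial_pays`: e·K ≤ n^{1−φ} ⟹ Kⁿ n^{φn} ≤ n! (the full factorial pays ANY fraction φ < 1);
 * `regimeA_bound`: Λ ≤ n ⟹ Kⁿ n^{φn} · (2ⁿ Λ^{(1−φ)n}/n!) ≤ (2K)ⁿ eⁿ;
 * `regimeB_bound`: n ≤ Λ ⟹ Kⁿ n^{φn}/(n!)^a ≤ (e^a K)ⁿ Λ^{(φ−a)n} (below the switch the count excess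
   n^{(φ−a)n} is at most Λ^{(φ−a)n});
 * `two_regime_bound`: for every n ≥ 1 the minimum of the two routes is ≤ (2eK)ⁿ · Λ^{(φ−a)n};
 * `excess_exponent_identity`: Λ^{(φ−a)n} = ε^{−κ·|a|} with κ = (φ − a)/ℓ̄ when |a| = ℓ̄·n·L_i;
 * `meanLength_values`, `kappaG_values`: ℓ̄ = (1−φ)(P+B) + φF and κ = (φ − 2/9)/ℓ̄ for the three families —
   F1 (φ = 15/64; P = 1, B = 0, F = 7/15): ℓ̄ = 7/8, κ = 1/72; F2 one element, short pinned (φ = 19/68;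
   B = 4/15): ℓ̄ = 266/255, κ = 25/456; F2 full chains, short pinned (φ = 165/508; B = 4/7): ℓ̄ = 154/127,
   κ = 67/792 — all below 1/2, and 67/792 above the event-side worst-case spare 1/14 of EventSide.lean;
 * `room_433_iff`: with γ = ε^{20} the printed room c^{8/7} γ^{1/7} ε^{−16/7} ≤ 1 of (4.32)–(4.33) is
   exactly c ≤ ε^{−1/2} (so c ↦ c·ε^{−κ} with κ < 1/2 stays admissible there, for ε small).
Audit-cell lemmas; nothing here is a statement of the paper, and nothing here says that §4.2.1 or any part of
§4 stands: the combinatorial premises of R1′ (which children are certified and non-resonant, mixed-scale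
children, the zeroth factor, erased-but-not-jump floating children, the event side) are NOT addressed
(SURVIVAL.md (R1′) "Unchecked in this sketch").  Cell verdict unchanged (LLA open for γ > 0; LLA-free part
conditional on §4.2.1, Q-P3′/Q-P3″(a)–(c)).
-/

namespace Literature.MathematicalPhysics.QuantumLattice.Imbrie2016

/-- n^{a·n} ≤ (eⁿ)^a · (n!)^a for 0 ≤ a: the printed budget (n!)^a pays a count n^{an} up to e^{an}
(a = 2/9 in the text). [cite: ImbrieJSP2016, §4.2.1 p0018 l.18] -/
theorem self_rpow_le_of_factorial (n : ℕ) {a : ℝ} (ha : 0 ≤ a) :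
    (n : ℝ) ^ (a * n) ≤ (Real.exp n) ^ a * ((n.factorial : ℝ)) ^ a := by
  have hn0 : (0 : ℝ) ≤ n := by positivity
  calc (n : ℝ) ^ (a * n) = ((n : ℝ) ^ n) ^ a := by
        rw [mul_comm, Real.rpow_natCast_mul hn0]
    _ ≤ (Real.exp n * n.factorial) ^ a :=
        Real.rpow_le_rpow (by positivity) (Literature.Combinatorics.SimpleGraph.pow_self_le_exp_mul_factorial n) ha
    _ = (Real.exp n) ^ a * ((n.factorial : ℝ)) ^ a := Real.mul_rpow (by positivity) (by positivity)

/-- eⁿ = (e¹)ⁿ, used to read the constants below as per-subgraph constants. [cite: ImbrieJSP2016, §4.2.1 p0018 l.16] -/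
theorem exp_nat_eq_exp_one_pow (n : ℕ) : Real.exp n = Real.exp 1 ^ n := by
  rw [← Real.exp_nat_mul, mul_one]

/-- REGIME A, first form (the text's "a combinatoric factor n! is admissible" whenever the expansion's 1/n! is
available): once e·K ≤ n^{1−φ}, the FULL top factorial pays the whole ordered count, Kⁿ · n^{φn} ≤ n!,
whatever the floating fraction φ. (Cell's sketch R1′; not in the text.) [cite: ImbrieJSP2016, §4.2.1 p0018 l.16; step 2 p0013 l.42] -/
theorem full_factorial_pays {K φ : ℝ} {n : ℕ} (hn : 1 ≤ n) (hK : 0 ≤ K)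
    (h : Real.exp 1 * K ≤ (n : ℝ) ^ (1 - φ)) :
    K ^ n * (n : ℝ) ^ (φ * n) ≤ n.factorial := by
  have hnpos : (0 : ℝ) < n := by exact_mod_cast hn
  have h3 : K * (n : ℝ) ^ φ * Real.exp 1 ≤ n := by
    have h' : Real.exp 1 * K * (n : ℝ) ^ φ ≤ (n : ℝ) ^ (1 - φ) * (n : ℝ) ^ φ :=
      mul_le_mul_of_nonneg_right h (by positivity)
    rw [← Real.rpow_add hnpos, sub_add_cancel, Real.rpow_one] at h'
    calc K * (n : ℝ) ^ φ * Real.exp 1 = Real.exp 1 * K * (n : ℝ) ^ φ := by ring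
      _ ≤ n := h'
  have h4 : (K * (n : ℝ) ^ φ * Real.exp 1) ^ n ≤ (n : ℝ) ^ n :=
    pow_le_pow_left₀ (by positivity) h3 n
  have h5 : (K * (n : ℝ) ^ φ * Real.exp 1) ^ n = K ^ n * (n : ℝ) ^ (φ * n) * Real.exp n := by
    rw [mul_pow, mul_pow, ← exp_nat_eq_exp_one_pow, ← Real.rpow_mul_natCast hnpos.le]
  have h6 : K ^ n * (n : ℝ) ^ (φ * n) * Real.exp n ≤ (n.factorial : ℝ) * Real.exp n := by
    rw [← h5]
    calc (K * (n : ℝ) ^ φ * Real.exp 1) ^ n ≤ (n : ℝ) ^ n := h4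
      _ ≤ Real.exp n * n.factorial := Literature.Combinatorics.SimpleGraph.pow_self_le_exp_mul_factorial n
      _ = (n.factorial : ℝ) * Real.exp n := mul_comm _ _
  exact le_of_mul_le_mul_right h6 (Real.exp_pos _)

/-- REGIME A of R1′ (n ≥ Λ): the ordered count Kⁿ n^{φn} against the condition-I route — full factorial 1/n!,
factor 2ⁿ, loss Λ^{(1−φ)n} (Λ = ε^{−L_i}; ε^{−ℓ_short} with ℓ_short ≤ (1−φ) n L_i) — is at most (2K)ⁿ eⁿ.
(Cell's sketch R1′; not in the text.) [cite: ImbrieJSP2016, (4.8)I p0016 l.27; (4.32) p0028 l.46; §4.2.1 p0018 l.16] -/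
theorem regimeA_bound {K φ Λ : ℝ} {n : ℕ} (hn : 1 ≤ n) (hK : 0 ≤ K) (hφ : φ ≤ 1) (hΛ : 0 ≤ Λ)
    (hreg : Λ ≤ n) :
    K ^ n * (n : ℝ) ^ (φ * n) * (2 ^ n * Λ ^ ((1 - φ) * n) / n.factorial)
      ≤ (2 * K) ^ n * Real.exp n := by
  have hnpos : (0 : ℝ) < n := by exact_mod_cast hn
  have hfac : (0 : ℝ) < n.factorial := by positivity
  have h1 : Λ ^ ((1 - φ) * n) ≤ (n : ℝ) ^ ((1 - φ) * n) :=
    Real.rpow_le_rpow hΛ hreg (mul_nonneg (by linarith) hnpos.le)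
  have h2 : (n : ℝ) ^ (φ * n) * (n : ℝ) ^ ((1 - φ) * n) = (n : ℝ) ^ n := by
    rw [← Real.rpow_add hnpos, ← Real.rpow_natCast]
    congr 1; ring
  have h1' : 2 ^ n * Λ ^ ((1 - φ) * n) / n.factorial ≤ 2 ^ n * (n : ℝ) ^ ((1 - φ) * n) / n.factorial :=
    div_le_div_of_nonneg_right (mul_le_mul_of_nonneg_left h1 (by positivity)) hfac.le
  calc K ^ n * (n : ℝ) ^ (φ * n) * (2 ^ n * Λ ^ ((1 - φ) * n) / n.factorial)
      ≤ K ^ n * (n : ℝ) ^ (φ * n) * (2 ^ n * (n : ℝ) ^ ((1 - φ) * n) / n.factorial) :=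
        mul_le_mul_of_nonneg_left h1' (by positivity)
    _ = (2 * K) ^ n * ((n : ℝ) ^ n / n.factorial) := by
        rw [mul_pow, ← h2]; ring
    _ ≤ (2 * K) ^ n * Real.exp n :=
        mul_le_mul_of_nonneg_left (Real.pow_div_factorial_le_exp (x := (n : ℝ)) hnpos.le n) (by positivity)

/-- REGIME B of R1′ (n ≤ Λ): against the printed budget (n!)^a the ordered count Kⁿ n^{φn} leaves the excess
n^{(φ−a)n} ≤ Λ^{(φ−a)n}; precisely Kⁿ n^{φn}/(n!)^a ≤ (e^a K)ⁿ Λ^{(φ−a)n}. (Cell's sketch R1′; not in the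
text.) [cite: ImbrieJSP2016, (4.8)II p0016 l.28; §4.2.1 p0018 l.18] -/
theorem regimeB_bound {K φ a Λ : ℝ} {n : ℕ} (hn : 1 ≤ n) (hK : 0 ≤ K) (ha : 0 ≤ a) (haφ : a ≤ φ)
    (hreg : (n : ℝ) ≤ Λ) :
    K ^ n * (n : ℝ) ^ (φ * n) / ((n.factorial : ℝ)) ^ a ≤ (Real.exp a * K) ^ n * Λ ^ ((φ - a) * n) := by
  have hnpos : (0 : ℝ) < n := by exact_mod_cast hn
  have hfac : (0 : ℝ) < n.factorial := by positivity
  have hfaca : (0 : ℝ) < ((n.factorial : ℝ)) ^ a := Real.rpow_pos_of_pos hfac a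
  have hΛ : 0 ≤ Λ := hnpos.le.trans hreg
  have hsplit : (n : ℝ) ^ (φ * n) = (n : ℝ) ^ ((φ - a) * n) * (n : ℝ) ^ (a * n) := by
    rw [← Real.rpow_add hnpos]; congr 1; ring
  have hex : (n : ℝ) ^ ((φ - a) * n) ≤ Λ ^ ((φ - a) * n) :=
    Real.rpow_le_rpow hnpos.le hreg (mul_nonneg (by linarith) hnpos.le)
  have hbud : (n : ℝ) ^ (a * n) ≤ (Real.exp n) ^ a * ((n.factorial : ℝ)) ^ a :=
    self_rpow_le_of_factorial n ha
  have hexpa : (Real.exp n) ^ a = (Real.exp a) ^ n := by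
    rw [← Real.exp_mul]; exact Real.exp_nat_mul a n
  rw [div_le_iff₀ hfaca, hsplit]
  calc K ^ n * ((n : ℝ) ^ ((φ - a) * n) * (n : ℝ) ^ (a * n))
      ≤ K ^ n * (Λ ^ ((φ - a) * n) * ((Real.exp n) ^ a * ((n.factorial : ℝ)) ^ a)) := by
        apply mul_le_mul_of_nonneg_left _ (by positivity)
        exact mul_le_mul hex hbud (by positivity) (by positivity)
    _ = (Real.exp a * K) ^ n * Λ ^ ((φ - a) * n) * ((n.factorial : ℝ)) ^ a := by
        rw [hexpa, mul_pow]; ring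

/-- THE TWO-REGIME BOUND of the cell's sketch R1′: for every n ≥ 1, 0 ≤ a ≤ φ ≤ 1, K ≥ 0, Λ ≥ 1, the minimum of
the threshold route Kⁿ n^{φn}/(n!)^a and the condition-I route Kⁿ n^{φn}·2ⁿΛ^{(1−φ)n}/n! is at most
(2eK)ⁿ · Λ^{(φ−a)n}: an admissible per-subgraph constant times the excess Λ^{(φ−a)n} = ε^{−(φ−a) n L_i}.
NOT a statement of the paper and NOT a repair claim: which children the two routes apply to is unchecked
(SURVIVAL.md (R1′)). [cite: ImbrieJSP2016, §4.2.1 p0018 l.16–18; (4.8) p0016 l.27–28; (4.32) p0028 l.46] -/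
theorem two_regime_bound {K φ a Λ : ℝ} {n : ℕ} (hn : 1 ≤ n) (hK : 0 ≤ K) (ha : 0 ≤ a) (haφ : a ≤ φ)
    (hφ : φ ≤ 1) (hΛ : 1 ≤ Λ) :
    min (K ^ n * (n : ℝ) ^ (φ * n) / ((n.factorial : ℝ)) ^ a)
        (K ^ n * (n : ℝ) ^ (φ * n) * (2 ^ n * Λ ^ ((1 - φ) * n) / n.factorial))
      ≤ (2 * Real.exp 1 * K) ^ n * Λ ^ ((φ - a) * n) := by
  have hnpos : (0 : ℝ) < n := by exact_mod_cast hn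
  have hΛ0 : 0 ≤ Λ := zero_le_one.trans hΛ
  have he1 : 0 < Real.exp 1 := Real.exp_pos 1
  have hΛpow : 1 ≤ Λ ^ ((φ - a) * n) := Real.one_le_rpow hΛ (mul_nonneg (by linarith) hnpos.le)
  rcases le_total Λ (n : ℝ) with hA | hB
  · refine (min_le_right _ _).trans ((regimeA_bound hn hK hφ hΛ0 hA).trans ?_)
    have hKe : (2 * K) ^ n * Real.exp n = (2 * Real.exp 1 * K) ^ n := by
      rw [exp_nat_eq_exp_one_pow, ← mul_pow]; congr 1; ring
    rw [hKe]
    exact le_mul_of_one_le_right (by positivity) hΛpow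
  · refine (min_le_left _ _).trans ((regimeB_bound hn hK ha haφ hB).trans ?_)
    have hea : Real.exp a ≤ Real.exp 1 := Real.exp_le_exp.mpr (haφ.trans hφ)
    have hbase : Real.exp a * K ≤ 2 * Real.exp 1 * K := by nlinarith [Real.exp_pos a]
    exact mul_le_mul_of_nonneg_right (pow_le_pow_left₀ (by positivity) hbase n) (by positivity)

/-- Reading the excess as a per-unit-length cost: with Λ = ε^{−L} and the child's length |a| = ℓ̄·n·L
(ℓ̄ = mean booked length per subgraph in units of L = L_i), Λ^{(φ−a)n} = ε^{−κ|a|} with κ = (φ − a)/ℓ̄.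
(Cell's sketch R1′.) [cite: ImbrieJSP2016, §4.2.1 p0018 l.18] -/
theorem excess_exponent_identity {ε L lbar φ a : ℝ} {n : ℕ} (hε : 0 < ε) (hl : lbar ≠ 0) :
    (ε ^ (-L)) ^ ((φ - a) * n) = ε ^ (-((φ - a) / lbar) * (lbar * n * L)) := by
  rw [← Real.rpow_mul hε.le]
  congr 1
  field_simp

/-- Mean booked length per subgraph, ℓ̄ = (1−φ)(P+B) + φF in units of L_i, for the cell's three families
(pinned length P = 1, floating jump steps at the floor F = 7/15 = (7/8)(8/15), booked gap B per pinned child):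
F1 (φ = 15/64, B = 0) ↦ 7/8; F2 one element short-pinned (φ = 19/68, B = 4/15) ↦ 266/255; F2 full chains
short-pinned (φ = 165/508, B = 4/7) ↦ 154/127.  Exact constants of the cell's families (FloatingRatio.lean:
`noGap_fraction`, `oneElement_shortPinned`, `fullChain_fractions`); not in the text. [cite: ImbrieJSP2016, §4.2.1 p0018 l.18; (4.4)] -/
theorem meanLength_values :
    (1 - (15 : ℚ) / 64) * (1 + 0) + (15 / 64) * (7 / 15) = 7 / 8 ∧
    (1 - (19 : ℚ) / 68) * (1 + 4 / 15) + (19 / 68) * (7 / 15) = 266 / 255 ∧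
    (1 - (165 : ℚ) / 508) * (1 + 4 / 7) + (165 / 508) * (7 / 15) = 154 / 127 := by
  norm_num

/-- The repair-sketch constants κ = (φ − a)/ℓ̄ at the printed a = 2/9 (SURVIVAL.md (R1′), §5 row "(rev. 6,
(iv⁗)(4) R1′)"): 1/72 (F1), 25/456 (F2 one element), 67/792 (F2 full chains); ordering 1/72 < 25/456 < 1/14
< 67/792 < 1/2 (1/14 = the event-side worst-case spare s/4 at s = 2/7, EventSide.lean `event_rooms`; 1/2 = the
room of (4.33), `room_433_iff`).  Previously "python exact fractions; NOT kernel-checked"; constants of a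
SKETCH, not of the paper. [cite: ImbrieJSP2016, §4.2.1 p0018 l.18; (4.33) p0028 l.52] -/
theorem kappaG_values :
    ((15 : ℚ) / 64 - 2 / 9) / (7 / 8) = 1 / 72 ∧
    ((19 : ℚ) / 68 - 2 / 9) / (266 / 255) = 25 / 456 ∧
    ((165 : ℚ) / 508 - 2 / 9) / (154 / 127) = 67 / 792 ∧
    (1 : ℚ) / 72 < 25 / 456 ∧ (25 : ℚ) / 456 < 1 / 14 ∧ (1 : ℚ) / 14 < 67 / 792 ∧
    (67 : ℚ) / 792 < 1 / 2 := by
  norm_num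

/-- The printed room of (4.32)–(4.33): with γ = ε^{20}, for 0 < ε and 0 < c,
c^{8/7} γ^{1/7} ε^{−16/7} ≤ 1 ⟺ c ≤ ε^{−1/2} ("Recall that γ = ε^{20}, so c^{8/7}γ^{1/7}ε^{−16/7} ≤ 1").
Hence a modified constant c·ε^{−κ} is admissible there iff c·ε^{−κ} ≤ ε^{−1/2}, which for κ < 1/2 holds once
ε^{1/2−κ} ≤ 1/c. [cite: ImbrieJSP2016, (4.32)–(4.33) p0028 l.52] -/
theorem room_433_iff {ε c : ℝ} (hε : 0 < ε) (hc : 0 < c) :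
    c ^ ((8 : ℝ) / 7) * (ε ^ (20 : ℝ)) ^ ((1 : ℝ) / 7) * ε ^ (-(16 : ℝ) / 7) ≤ 1 ↔
      c ≤ ε ^ (-(1 : ℝ) / 2) := by
  have hε0 : 0 ≤ ε := hε.le
  have hsq : 0 < ε ^ ((1 : ℝ) / 2) := Real.rpow_pos_of_pos hε _
  -- the left-hand side is (c · ε^{1/2})^{8/7}
  have hL : c ^ ((8 : ℝ) / 7) * (ε ^ (20 : ℝ)) ^ ((1 : ℝ) / 7) * ε ^ (-(16 : ℝ) / 7)
      = (c * ε ^ ((1 : ℝ) / 2)) ^ ((8 : ℝ) / 7) := by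
    rw [← Real.rpow_mul hε0, Real.mul_rpow hc.le hsq.le, ← Real.rpow_mul hε0, mul_assoc,
      ← Real.rpow_add hε]
    norm_num
  -- the right-hand side says c · ε^{1/2} ≤ 1
  have hR : c ≤ ε ^ (-(1 : ℝ) / 2) ↔ c * ε ^ ((1 : ℝ) / 2) ≤ 1 := by
    rw [neg_div, Real.rpow_neg hε0, inv_eq_one_div, le_div_iff₀ hsq]
  rw [hL, hR]
  have hx : 0 < c * ε ^ ((1 : ℝ) / 2) := mul_pos hc hsq
  constructor
  · intro h
    by_contra hgt
    rw [not_le] at hgt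
    have h1 : 1 < (c * ε ^ ((1 : ℝ) / 2)) ^ ((8 : ℝ) / 7) :=
      Real.one_lt_rpow hgt (by norm_num)
    linarith
  · intro h
    exact Real.rpow_le_one hx.le h (by norm_num)

end Literature.MathematicalPhysics.QuantumLattice.Imbrie2016
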